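import Mathlib
import Summits.Ventures.DiscreteObjects.Mahler.CensusSearchFast

/-!
# The fast census search with in-kernel elimination of small-cyclotomic-divisible leaves (venture `DiscreteObjects`, target L)

Cell `pub-namedobj`, seat `pub-namedobj-mahler-g19`. Framing: lottery ticket; floor = certified bounds/negative ranges.

`censusSearchG` is `censusSearchF` (mahler g19, `CensusSearchFast`: sparse cut rows, affine last level, fused leaf test) whose
leaf test additionally DROPS a leaf whose polynomial is divisible by `x ± 1`, `Φ₃`, `Φ₄` or `Φ₆`, detected in the kernel by a
cheap residue-sum pre-test and an exact
power-series division (`quotLow`) validated by the reducibility check of the census certificates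
(`checkCert … (Cert.red f q)`, mahler g12): such a leaf is reducible, so it needs no certificate in the census parts.  At degree 24
(seat g18) 25 957 of the 36 330 survivors were of this kind; dropping them in the kernel removes their certificate text from the
chunk parts (the dominant size of a census package) and their trace.  The transfer theorem `forall_certX_of_allCertifiedG`
turns a kernel check `allCertifiedX … (censusSearchG …) certs = true` into certificates for EVERY survivor of `censusSearchC`
(the dropped ones get the `red` certificate found by the kernel), so the census verdict `degreeCensus_of_certified_nonnegXC`
applies unchanged.  Infrastructure only; CONTROL/replication pipeline for the degree-26 row at the Lehmer bound.
-/

namespace Summit.Ventures.DiscreteObjects.Mahler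

open Polynomial

/-! ## Exact division by a polynomial with unit constant term (ascending lists) -/

/-- Power-series division from the low end: `m` quotient coefficients of `r / f`, where `f0inv = f₀ = ±1`. Untrusted
(the result is validated by `lpEq (lpMul f q) asc`). -/
def quotLow (f : List ℤ) (f0inv : ℤ) : ℕ → List ℤ → List ℤ
  | 0, _ => []
  | m + 1, r =>
    let c := f0inv * r.headD 0
    c :: quotLow f f0inv m (lpAdd r (lpSMul (-c) f)).tail

/-- The reducibility check of the census certificates for the factor `f` with the quotient found by `quotLow`. -/
def junkFactor (asc f : List ℤ) (f0inv : ℤ) (m : ℕ) : Bool :=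
  lpPosDegree f && lpPosDegree (quotLow f f0inv m asc) && lpEq (lpMul f (quotLow f f0inv m asc)) asc

/-- Sums of the entries in the residue classes mod 12 of the positions (input padded to a multiple of 12). -/
def bins12 : List ℤ → ℤ → ℤ → ℤ → ℤ → ℤ → ℤ → ℤ → ℤ → ℤ → ℤ → ℤ → ℤ → List ℤ
  | a0 :: a1 :: a2 :: a3 :: a4 :: a5 :: a6 :: a7 :: a8 :: a9 :: a10 :: a11 :: rest,
      b0, b1, b2, b3, b4, b5, b6, b7, b8, b9, b10, b11 =>
    bins12 rest (b0 + a0) (b1 + a1) (b2 + a2) (b3 + a3) (b4 + a4) (b5 + a5) (b6 + a6) (b7 + a7) (b8 + a8) (b9 + a9)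
      (b10 + a10) (b11 + a11)
  | _, b0, b1, b2, b3, b4, b5, b6, b7, b8, b9, b10, b11 => [b0, b1, b2, b3, b4, b5, b6, b7, b8, b9, b10, b11]

/-- Cheap necessary tests (values at the roots of unity of order 1, 2, 3, 4, 6) from the residue sums `b`; heuristic filters only
(soundness rests on the validated factorisation). Order: `[x-1, x+1, Φ₃, Φ₄, Φ₆]`. -/
def junkPre (b : List ℤ) : List Bool :=
  let g := fun i => b.getD i 0
  let s0 := g 0 + g 3 + g 6 + g 9
  let s1 := g 1 + g 4 + g 7 + g 10
  let s2 := g 2 + g 5 + g 8 + g 11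
  let t0 := g 0 + g 6
  let t1 := g 1 + g 7
  let t2 := g 2 + g 8
  let t3 := g 3 + g 9
  let t4 := g 4 + g 10
  let t5 := g 5 + g 11
  [decide (s0 + s1 + s2 = 0), decide (t0 - t1 + t2 - t3 + t4 - t5 = 0), decide (s0 = s2 ∧ s1 = s2),
    decide (g 0 - g 2 + g 4 - g 6 + g 8 - g 10 = 0 ∧ g 1 - g 3 + g 5 - g 7 + g 9 - g 11 = 0),
    decide (t0 - t2 - t3 + t5 = 0 ∧ t1 + t2 - t4 - t5 = 0)]

/-- `asc` (ascending coefficients, `m + 1` of them) is divisible by `x - 1`, `x + 1`, `Φ₃`, `Φ₄` or `Φ₆`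
(cheap residue pre-test, then a validated factorisation). -/
def junk (asc : List ℤ) (m : ℕ) : Bool :=
  let pre := junkPre (bins12 (asc ++ List.replicate 11 0) 0 0 0 0 0 0 0 0 0 0 0 0)
  (pre.getD 0 false && junkFactor asc [-1, 1] (-1) m) || (pre.getD 1 false && junkFactor asc [1, 1] 1 m) ||
    (pre.getD 2 false && junkFactor asc [1, 1, 1] 1 (m - 1)) || (pre.getD 3 false && junkFactor asc [1, 0, 1] 1 (m - 1)) ||
    (pre.getD 4 false && junkFactor asc [1, -1, 1] 1 (m - 1))

/-- A positive junk test IS a valid `red` certificate. -/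
theorem exists_certX_of_junk {Bn Bd d : ℕ} {L : List (List ℤ)} {LC : List (List ℤ × ℤ)} {asc : List ℤ} {m : ℕ}
    (h : junk asc m = true) : ∃ c, checkCertX Bn Bd d L LC asc c = true := by
  unfold junk at h
  simp only [Bool.or_eq_true, Bool.and_eq_true] at h
  rcases h with (((⟨_, h⟩ | ⟨_, h⟩) | ⟨_, h⟩) | ⟨_, h⟩) | ⟨_, h⟩
  · exact ⟨CertX.base (Cert.red [-1, 1] (quotLow [-1, 1] (-1) m asc)), h⟩
  · exact ⟨CertX.base (Cert.red [1, 1] (quotLow [1, 1] 1 m asc)), h⟩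
  · exact ⟨CertX.base (Cert.red [1, 1, 1] (quotLow [1, 1, 1] 1 (m - 1) asc)), h⟩
  · exact ⟨CertX.base (Cert.red [1, 0, 1] (quotLow [1, 0, 1] 1 (m - 1) asc)), h⟩
  · exact ⟨CertX.base (Cert.red [1, -1, 1] (quotLow [1, -1, 1] 1 (m - 1) asc)), h⟩

/-! ## Leaf test with the junk check after `cd` steps -/

/-- `leafPassF` with a countdown: after `cd` Newton steps the junk test is run once; a junk leaf is dropped. -/
def leafPassJ (cs asc : List ℤ) (m : ℕ) : ℕ → List ℤ → ℤ → List ℕ → List ℤ → Bool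
  | 0, ct, k, ts, ps => !(junk asc m) && leafPassF cs ct k ts ps
  | _ + 1, _, _, [], _ => !(junk asc m)
  | cd + 1, ct, k, t :: ts, ps =>
    let p := -(k * ct.getD 0 0) - dotAcc cs ps 0
    decide (p.natAbs ≤ t) && leafPassJ cs asc m cd ct.tail (k + 1) ts (p :: ps)

/-- For a non-junk leaf the countdown test is the fused test. -/
theorem leafPassJ_eq_of_not_junk {cs asc : List ℤ} {m : ℕ} (hj : junk asc m = false) :
    ∀ (cd : ℕ) (ct : List ℤ) (k : ℤ) (ts : List ℕ) (ps : List ℤ),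
      leafPassJ cs asc m cd ct k ts ps = leafPassF cs ct k ts ps := by
  intro cd
  induction cd with
  | zero => intro ct k ts ps; simp [leafPassJ, hj]
  | succ cd ih =>
    intro ct k ts ps
    cases ts with
    | nil => simp [leafPassJ, leafPassF, hj]
    | cons t ts => simp only [leafPassJ, leafPassF, ih]

/-! ## The search -/

/-- **The fast census search dropping `x ± 1, Φ₃, Φ₄, Φ₆`-divisible leaves** (`NJ` = Newton steps before the junk test). -/
def censusSearchG (T : List ℕ) (CTs : List (List SCut)) (NJ : ℕ) : ℕ → List ℤ → List ℤ → List (List ℤ)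
  | 0, pre, ps =>
    let n := pre.length
    let cs := palC pre
    if leafPassJ cs (1 :: cs) (cs.length) NJ (cs.drop n) (((n : ℕ) : ℤ) + 1) (T.drop n) ps then [pre] else []
  | fuel + 1, pre, ps =>
    let n := pre.length
    let R : ℤ := -(dotAcc pre ps 0)
    let kz : ℤ := ((n + 1 : ℕ) : ℤ)
    let Tk : ℤ := ((T.getD n 0 : ℕ) : ℤ)
    let b := cutBoundsS (CTs.getD n []) ps (-Tk) Tk
    let lo := -((b.2 - R) / kz)
    let hi := (R - b.1) / kz
    if fuel = 0 then
      match T.drop (n + 1) with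
      | [] => (icc lo hi).flatMap fun ak => censusSearchG T CTs NJ fuel (pre ++ [ak]) ((-(kz * ak) + R) :: ps)
      | t :: ts =>
        let U : ℤ := -((kz + 1) * pre.getD (n - 1) 0) - pre.getD 0 0 * R - dotAcc (pre.drop 1) ps 0
        let V : ℤ := kz * pre.getD 0 0 - ps.getD (n - 1) 0
        let w := affWindow U V t lo hi
        (icc w.1 w.2).flatMap fun ak =>
          let cs := palC (pre ++ [ak])
          if leafPassJ cs (1 :: cs) (cs.length) NJ (cs.drop (n + 2)) (kz + 2) ts ((U + V * ak) :: (-(kz * ak) + R) :: ps)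
          then [pre ++ [ak]] else []
    else (icc lo hi).flatMap fun ak => censusSearchG T CTs NJ fuel (pre ++ [ak]) ((-(kz * ak) + R) :: ps)

/-- **Transfer**: every survivor of `censusSearchC` is a survivor of `censusSearchG` or a junk leaf
(`densifyTable CTs = CT`, `|ps| = |pre| ≥ 1`). -/
theorem mem_censusSearchG_or_junk {T : List ℕ} {CT : List (List (List ℤ × ℤ))} {CTs : List (List SCut)} {NJ : ℕ}
    (hCT : densifyTable CTs = CT) : ∀ (fuel : ℕ) (pre ps a : List ℤ), ps.length = pre.length → 1 ≤ pre.length →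
      a ∈ censusSearchC T CT fuel pre ps →
        a ∈ censusSearchG T CTs NJ fuel pre ps ∨ junk (1 :: palC a) (palC a).length = true := by
  intro fuel
  induction fuel with
  | zero =>
    intro pre ps a hlen _ ha
    rw [censusSearchC] at ha
    split_ifs at ha with hleaf
    · simp only [List.mem_singleton] at ha
      subst ha
      by_cases hj : junk (1 :: palC a) (palC a).length = true
      · exact Or.inr hj
      · left
        rw [censusSearchG]
        simp only [Bool.not_eq_true] at hj
        rw [leafPassJ_eq_of_not_junk hj, ← hlen, leafPassF_eq, hlen]
        simp [hleaf]
    · simp at ha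
  | succ fuel ih =>
    intro pre ps a hlen h1 ha
    rw [mem_censusSearchC_succ_iff] at ha
    obtain ⟨ak, hak, ha⟩ := ha
    rw [mem_icc] at hak
    obtain ⟨hlo, hhi⟩ := hak
    obtain ⟨hloF, hhiF⟩ := rangeF_eq (T := T) hCT pre ps
    have hlen' : (nodeP pre ps ak :: ps).length = (pre ++ [ak]).length := by simp [hlen]
    have h1' : 1 ≤ (pre ++ [ak]).length := by simp
    have hP : nodeP pre ps ak = -((((pre.length + 1 : ℕ) : ℤ)) * ak) + -(dotAcc pre ps 0) := by
      rw [nodeP, dotAcc_eq, zero_add]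
    by_cases hj : junk (1 :: palC a) (palC a).length = true
    · exact Or.inr hj
    left
    have ih' : ∀ (pre ps : List ℤ), ps.length = pre.length → 1 ≤ pre.length →
        a ∈ censusSearchC T CT fuel pre ps → a ∈ censusSearchG T CTs NJ fuel pre ps := by
      intro pre ps hl h1 h
      rcases ih pre ps a hl h1 h with h | h
      · exact h
      · exact absurd h hj
    rw [censusSearchG]
    dsimp only
    split_ifs with hf
    · subst hf
      cases hT : T.drop (pre.length + 1) with
      | nil =>
        simp only [List.mem_flatMap, mem_icc]
        refine ⟨ak, ⟨by rw [hloF]; exact hlo, by rw [hhiF]; exact hhi⟩, ?_⟩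
        rw [← hP]
        exact ih' _ _ hlen' h1' ha
      | cons t ts =>
        rw [censusSearchC] at ha
        simp only [List.length_append, List.length_singleton, hT] at ha
        split_ifs at ha with hleaf
        · simp only [List.mem_singleton] at ha
          subst ha
          rw [leafPass, Bool.and_eq_true, decide_eq_true_eq] at hleaf
          obtain ⟨h14, hrest⟩ := hleaf
          have hid := newtonNext_palC_snoc pre ps ak (nodeP pre ps ak) hlen h1
          set U : ℤ := -(((((pre.length + 1 : ℕ)) : ℤ) + 1) * pre.getD (pre.length - 1) 0) -
              pre.getD 0 0 * -(dotAcc pre ps 0) - dotAcc (pre.drop 1) ps 0 with hU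
          set V : ℤ := (((pre.length + 1 : ℕ)) : ℤ) * pre.getD 0 0 - ps.getD (pre.length - 1) 0 with hV
          have hUV : newtonNext (palC (pre ++ [ak])) (nodeP pre ps ak :: ps) = U + V * ak := by
            rw [hid, hU, hV, hP, dotAcc_eq, dotAcc_eq, zero_add, zero_add]; push_cast; ring
          rw [hUV] at h14 hrest
          simp only [List.mem_flatMap, mem_icc]
          refine ⟨ak, affWindow_spec U V _ _ ak t h14 (by rw [hloF]; exact hlo) (by rw [hhiF]; exact hhi), ?_⟩
          simp only [Bool.not_eq_true] at hj
          have hF : leafPassJ (palC (pre ++ [ak])) (1 :: palC (pre ++ [ak])) (palC (pre ++ [ak])).length NJ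
              ((palC (pre ++ [ak])).drop (pre.length + 2))
              ((((pre.length + 1 : ℕ)) : ℤ) + 2) ts ((U + V * ak) :: nodeP pre ps ak :: ps) = true := by
            rw [leafPassJ_eq_of_not_junk hj]
            have := leafPassF_eq (palC (pre ++ [ak])) ts ((U + V * ak) :: nodeP pre ps ak :: ps)
            simp only [List.length_cons, hlen] at this
            rw [show pre.length + 1 + 1 = pre.length + 2 from rfl] at this
            have e : ((((pre.length + 1 : ℕ)) : ℤ) + 2) = (((pre.length + 2 : ℕ) : ℤ) + 1) := by push_cast; ring
            rw [e, this]
            exact hrest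
          rw [← hP]
          simp only [hF, if_true, List.mem_singleton]
        · simp at ha
    · simp only [List.mem_flatMap, mem_icc]
      refine ⟨ak, ⟨by rw [hloF]; exact hlo, by rw [hhiF]; exact hhi⟩, ?_⟩
      rw [← hP]
      exact ih' _ _ hlen' h1' ha

/-- **Kernel-check form**: certificates for the survivors of `censusSearchG` certify every survivor of `censusSearchC`
(junk leaves carry the `red` certificate found by the kernel). -/
theorem forall_certX_of_allCertifiedG {Bn Bd d : ℕ} {L : List (List ℤ)} {LC : List (List ℤ × ℤ)} {T : List ℕ}
    {CT : List (List (List ℤ × ℤ))} {CTs : List (List SCut)} (hCT : densifyTable CTs = CT) {NJ fuel : ℕ}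
    {pre ps : List ℤ} (hlen : ps.length = pre.length) (h1 : 1 ≤ pre.length) (certs : List CertX)
    (h : allCertifiedX Bn Bd d L LC (censusSearchG T CTs NJ fuel pre ps) certs = true) :
    ∀ a ∈ censusSearchC T CT fuel pre ps, ∃ c, checkCertX Bn Bd d L LC (1 :: palC a) c = true := by
  intro a ha
  rcases mem_censusSearchG_or_junk (NJ := NJ) hCT fuel pre ps a hlen h1 ha with hG | hj
  · exact exists_certX_of_allCertifiedX _ certs h a hG
  · exact exists_certX_of_junk hj

end Summit.Ventures.DiscreteObjects.Mahler
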